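import Summits.ABC.IUTFork.LDHGenuinePerImage
import HarnessLib

/-!
# Readings (P) and (U) of `−|log(Θ)|` COINCIDE on slot-constant data (in particular for `F_mod` of degree one)

Record-only file (D-0012) of the abc-iut cell (campaign-S seat abc-iut-S7; abc-iut-plan ruling 2026-08-26T02:51:47Z
"(P)-object", item (b) «equality on SlotConstant»); TAKES NO SIDE. [IUTchIII] Cor. 3.12 p. 174 (reading (U): the hull
of the UNION of the possible images) vs proof Step (x) p. 181 l. 2–32 (reading (P): one image's hull); [IUTchIV]
Thm. 1.10 Step (v) p. 27–28; Dupuy–Hilado, arXiv:2004.13228 §3.9, §4.7, §4.11–4.12. plan/c312/STEPV-IND1-NOTE.md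
«WHEN IT IS VOID: if all places of F_mod over p … have the same j²·ord_p(q_v) … hull(⋃ A_{i†}) = hull(A_j)» —
kernel: abc-iut-c312-d1's `iota_smul_normalizedPacket_eq_of_norm_eq` (equal-size twists at different slots span the
same translate of `(R_I)^∼`).

For the Dupuy–Hilado datum `ofInput I` of a genuine Θ-volume input (SHARP (Ind3) datum):
* `realPrimePacketWith_localUnion_eq_slotUnion_of_norm_eq` — in the real packet, if the theta values along a
  collection `v⃗` all have the same absolute value, the whole local (Ind2)·(Ind1)-orbit of the bare regions
  `⋃_{g,σ} g·perm_σ(t_{v_{σ(j)}}·O_{v⃗∘σ})` EQUALS the (Ind2)-orbit `⋃_g g·(t_{v_j}·O_{v⃗})` as a SET (every (Ind1)-moved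
  twist is the same translate); `PrimePacket.possibleImagesHull_eq_slotImagesHull_of_eq_with` — hence the two hulls
  and their log-volumes agree, for any packet equal to the real one and theta values constant on `v⃗`;
* `logμ_hullUTheta_eq_hullUThetaSlot_ofInput` — at a prime `p` where the canonical `log(q_v)` is SLOT-CONSTANT on
  `V(F₀)_p` (c312-d1's `hconst`), every component of `hull(U_Θ)` of `ofInput I` equals the corresponding component of
  `hull(U_Θ^slot)` in log-volume; `negLogThetaNonarch_eq_perImage_of_slotConstant` — summed: `negLogThetaNonarch I =
  negLogThetaPerImageNonarch I` when `hconst` holds at every support prime; hence **`cor312Of_iff_perImage_of_slotConstant :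
  I.Cor312Of ↔ I.Cor312PerImageOf`**, `hullEstimateOf_iff_perImage_of_slotConstant`, and the degree-one specialisations
  `…_of_finrank_eq_one` (`F_mod` of degree one: one place over each prime, abc-iut-c312-d1's
  `slotConstant_of_finrank_eq_one`) — the two readings are THE SAME CLAIM at `d_mod = 1`.
[cite: Mochizuki2012, IUTchIII Cor. 3.12 p. 174] [cite: Mochizuki2012, IUTchIII Cor. 3.12 proof Step (x) p. 181]
[cite: Mochizuki2012, IUTchIV Thm. 1.10 Step (v) p. 27–28] [cite: DupuyHilado2025, §3.9, §4.7, §4.11–4.12]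
[claim: Mochizuki2012, status: disputed] HONEST SCOPE: nothing asserts Cor. 3.12 in either reading; typed ≠ proved.
-/

noncomputable section

open Set MeasureTheory NumberField IsDedekindDomain
open scoped Pointwise TensorProduct

namespace Literature.IUT.LogVolume

/-! ## The real packet: on a collection with equal-size theta values the (Ind1)-union adds nothing -/

section RealPacketWith

variable {F : Type} [Field F] [NumberField F]
variable (p : ℕ) [Fact p.Prime] (𝔽 : LocalFields F p)
variable (c : (j : ℕ) → (Fin (j + 1) → placesOver F p) → ℚ_[p]) (hc0 : ∀ j e, c j e ≠ 0)
  (hcσ : ∀ (j : ℕ) (σ : Equiv.Perm (Fin (j + 1))) (e : Fin (j + 1) → placesOver F p), c j (e ∘ σ) = c j e)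

/-- **Equal-size theta values: the local (Ind2)·(Ind1)-orbit IS the (Ind2)-orbit.** In the real packet, degree `j`,
collection `v⃗`, theta values `t_v ∈ K_{v̲}^×` with `‖t_{v_a}‖ = ‖t_{v_j}‖` for every slot `a`, and SHARP (Ind3)-data
`B_{v⃗∘σ} = t_{v_{σ(j)}}·O_{v⃗∘σ}`: `⋃_{g,σ} g·perm_σ(B_{v⃗∘σ}) = ⋃_g g·B_{v⃗}` (abc-iut-c312-d1's
`iota_smul_normalizedPacket_eq_of_norm_eq`: `ι_{σ(j)}(t_{v_{σ(j)}})·(R_I)^∼ = ι_j(t_{v_j})·(R_I)^∼`).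
[cite: Mochizuki2012, IUTchIV Thm 1.10 proof Step (v) p.27–28] -/
theorem realPrimePacketWith_localUnion_eq_slotUnion_of_norm_eq {j : ℕ} (e : Fin (j + 1) → placesOver F p)
    (t : ∀ v : placesOver F p, (𝔽.k v)ˣ)
    (B : (realPrimePacketWith p 𝔽 c hc0 hcσ).Region)
    (hB : ∀ σ : Equiv.Perm (Fin (j + 1)), B j (e ∘ σ) =
      (realPrimePacketWith p 𝔽 c hc0 hcσ).peel (e := e ∘ σ) (t (e (σ (Fin.last j)))) ''
        (realPrimePacketWith p 𝔽 c hc0 hcσ).O j (e ∘ σ))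
    (hnorm : ∀ a, ‖(t (e a) : 𝔽.k (e a))‖ = ‖(t (e (Fin.last j)) : 𝔽.k (e (Fin.last j)))‖) :
    (⋃ (g : (realPrimePacketWith p 𝔽 c hc0 hcσ).G₂ j e) (σ : Equiv.Perm (Fin (j + 1))),
        g • ((realPrimePacketWith p 𝔽 c hc0 hcσ).perm σ e '' B j (e ∘ σ))) =
      ⋃ g : (realPrimePacketWith p 𝔽 c hc0 hcσ).G₂ j e, g • B j e := by
  haveI : Nonempty (Fin (j + 1)) := ⟨0⟩
  -- every (Ind1)-moved bare region is the twist at the last slot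
  have hlast : B j e = iota p (fun i => 𝔽.k (e i)) (Fin.last j) (t (e (Fin.last j)) : 𝔽.k (e (Fin.last j))) •
      (normalizedPacket p (fun i => 𝔽.k (e i)) : Set (PacketAlgebra p (fun i => 𝔽.k (e i)))) := by
    have h := hB 1
    rw [realPrimePacketWith_peel_image', realPrimePacketWith_O'] at h
    exact h
  have hσ : ∀ σ : Equiv.Perm (Fin (j + 1)),
      (realPrimePacketWith p 𝔽 c hc0 hcσ).perm σ e '' B j (e ∘ σ) = B j e := by
    intro σ
    rw [hB σ, realPrimePacketWith_perm_image_bare p 𝔽 c hc0 hcσ σ e (t (e (σ (Fin.last j)))), hlast]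
    exact iota_smul_normalizedPacket_eq_of_norm_eq p (fun i => 𝔽.k (e i)) (DFac p (fun i => 𝔽.k (e i)))
      (dEquiv p (fun i => 𝔽.k (e i))) (σ (Fin.last j)) (Fin.last j) (t (e (σ (Fin.last j)))).ne_zero
      (hnorm (σ (Fin.last j)))
  ext x
  simp only [Set.mem_iUnion]
  constructor
  · rintro ⟨g, σ, hx⟩
    exact ⟨g, by rwa [hσ σ] at hx⟩
  · rintro ⟨g, hx⟩
    exact ⟨g, 1, by rwa [hσ 1]⟩

end RealPacketWith

/-! ## Equal hulls on slot-constant collections: the real packet, then any packet equal to it -/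

section RealPacketWithPilot

variable {F : Type} [Field F] [NumberField F]
variable (p : ℕ) [Fact p.Prime] (𝔽 : LocalFields F p)
variable (c : (j : ℕ) → (Fin (j + 1) → placesOver F p) → ℚ_[p]) (hc0 : ∀ j e, c j e ≠ 0)
  (hcσ : ∀ (j : ℕ) (σ : Equiv.Perm (Fin (j + 1))) (e : Fin (j + 1) → placesOver F p), c j (e ∘ σ) = c j e)
variable (X : PilotData F)

/-- **The two hulls coincide on a slot-constant collection, in the real packet**: for the theta idele `t` with
`ord_v(t_{j,v}) = P_{Θ,j}(v)`, a degree `j = i+1`, a collection `v⃗` on which the theta VALUE `P_{Θ,j}(v)·ln|κ(v)|/n_v`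
is constant, and a SHARP region `B = O_𝕃(−div t)` on the `𝔖_{j+1}`-orbit of `v⃗`:
`hull(⋃_{g,σ} g·perm_σ(B_{v⃗∘σ})) = hull(⋃_g g·B_{v⃗})`. [cite: Mochizuki2012, IUTchIV Thm 1.10 proof Step (v) p.27–28] -/
theorem realPrimePacketWith_possibleImagesHull_eq_slotImagesHull (i : Fin X.lstar)
    (e : Fin ((i : ℕ) + 1 + 1) → placesOver F p)
    (t : Fin X.lstar → (v : placesOver F p) → (𝔽.k v)ˣ)
    (ht : ∀ v : placesOver F p, 𝔽.ordv (t i v) = X.thetaPilot i v.1)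
    (hθ : ∀ a, X.thetaPilot i (e a).1 * logNorm F (e a).1 / localDegree F (e a).1 =
      X.thetaPilot i (e (Fin.last _)).1 * logNorm F (e (Fin.last _)).1 / localDegree F (e (Fin.last _)).1)
    (B : (realPrimePacketWith p 𝔽 c hc0 hcσ).Region)
    (hB : ∀ σ : Equiv.Perm (Fin ((i : ℕ) + 1 + 1)),
      B _ (e ∘ σ) = (realPrimePacketWith p 𝔽 c hc0 hcσ).pilotRegion t ((i : ℕ) + 1) (e ∘ σ)) :
    (realPrimePacketWith p 𝔽 c hc0 hcσ).possibleImagesHull B _ e =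
      (realPrimePacketWith p 𝔽 c hc0 hcσ).slotImagesHull B _ e := by
  -- equal theta values give equal absolute values of the theta scalars
  have hlog : ∀ a, Real.log ‖(t i (e a) : 𝔽.k (e a))‖ =
      -(X.thetaPilot i (e a).1 * logNorm F (e a).1 / localDegree F (e a).1) := by
    intro a
    rw [𝔽.log_norm_eq_neg_ordv (t i (e a)), ht (e a), neg_mul, neg_div]
  have hnorm : ∀ a, ‖(t i (e a) : 𝔽.k (e a))‖ = ‖(t i (e (Fin.last _)) : 𝔽.k (e (Fin.last _)))‖ := by
    intro a
    have h1 : Real.log ‖(t i (e a) : 𝔽.k (e a))‖ =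
        Real.log ‖(t i (e (Fin.last _)) : 𝔽.k (e (Fin.last _)))‖ := by
      rw [hlog, hlog, hθ a]
    exact Real.log_injOn_pos (Set.mem_Ioi.mpr (norm_pos_iff.mpr (t i (e a)).ne_zero))
      (Set.mem_Ioi.mpr (norm_pos_iff.mpr (t i (e (Fin.last _))).ne_zero)) h1
  have hB' : ∀ σ : Equiv.Perm (Fin ((i : ℕ) + 1 + 1)), B _ (e ∘ σ) =
      (realPrimePacketWith p 𝔽 c hc0 hcσ).peel (e := e ∘ σ) (t i (e (σ (Fin.last _)))) ''
        (realPrimePacketWith p 𝔽 c hc0 hcσ).O _ (e ∘ σ) := by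
    intro σ
    rw [hB σ, PrimePacket.pilotRegion_succ_eq]
    rfl
  show (realPrimePacketWith p 𝔽 c hc0 hcσ).hullLoc _ e _ = (realPrimePacketWith p 𝔽 c hc0 hcσ).hullLoc _ e _
  unfold PrimePacket.possibleImages PrimePacket.slotImages
  rw [realPrimePacketWith_localUnion_eq_slotUnion_of_norm_eq p 𝔽 c hc0 hcσ e (t i) B hB' hnorm]

end RealPacketWithPilot

namespace PrimePacket

variable {F : Type} [Field F] [NumberField F]
variable {p : ℕ} [Fact p.Prime] (𝔽 : LocalFields F p)
variable (c : (j : ℕ) → (Fin (j + 1) → placesOver F p) → ℚ_[p]) (hc0 : ∀ j e, c j e ≠ 0)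
  (hcσ : ∀ (j : ℕ) (σ : Equiv.Perm (Fin (j + 1))) (e : Fin (j + 1) → placesOver F p), c j (e ∘ σ) = c j e)
variable (X : PilotData F)

/-- **The two hulls coincide on a slot-constant collection**, for ANY prime packet EQUAL to the real one (the `p`-part
of a model assembled by `ofPrimesLine`). [cite: Mochizuki2012, IUTchIV Thm 1.10 proof Step (v) p.27–28] -/
theorem possibleImagesHull_eq_slotImagesHull_of_eq_with (Q : PrimePacket F p)
    (hQ : Q = realPrimePacketWith p 𝔽 c hc0 hcσ)
    (t : Fin X.lstar → (v : placesOver F p) → Q.Λ v) (i : Fin X.lstar)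
    (ht : ∀ v : placesOver F p, Q.ordv (t i v) = X.thetaPilot i v.1)
    (e : Fin ((i : ℕ) + 1 + 1) → placesOver F p)
    (hθ : ∀ a, X.thetaPilot i (e a).1 * logNorm F (e a).1 / localDegree F (e a).1 =
      X.thetaPilot i (e (Fin.last _)).1 * logNorm F (e (Fin.last _)).1 / localDegree F (e (Fin.last _)).1)
    (B : Q.Region) (hB : ∀ σ : Equiv.Perm (Fin ((i : ℕ) + 1 + 1)), B _ (e ∘ σ) = Q.pilotRegion t ((i : ℕ) + 1) (e ∘ σ)) :
    Q.possibleImagesHull B _ e = Q.slotImagesHull B _ e := by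
  subst hQ
  exact realPrimePacketWith_possibleImagesHull_eq_slotImagesHull p 𝔽 c hc0 hcσ X i e t ht hθ B hB

end PrimePacket

end Literature.IUT.LogVolume

namespace Summit.ABC.IUTFork

namespace DHData

open Finset Literature.IUT.LogVolume Literature.IUT.LogVolume.Thm110Local NumberField IsDedekindDomain

variable {F₀ : Type} [Field F₀] [NumberField F₀] {K : Type} [Field K] [NumberField K] [Algebra F₀ K]
variable (I : ThetaVolumeInput F₀ K)

/-! ## The genuine datum: at a slot-constant prime the components of the two hulls have the same volume -/

/-- **At a prime where the canonical `log(q_v)` is SLOT-CONSTANT on `V(F₀)_p`** (abc-iut-c312-d1's `hconst`; e.g. one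
place of `F_mod` over `p`), every component of `hull(U_Θ)` of `ofInput I` in a degree `j = i+1 ≤ ℓ⋇` has the SAME
log-volume as the component of `hull(U_Θ^slot)`: the (Ind1)-union adds nothing. [cite: Mochizuki2012, IUTchIV Thm 1.10 proof Step (v) p.27–28] -/
theorem logμ_hullUTheta_eq_hullUThetaSlot_ofInput {p : ℕ} [hp : Fact p.Prime]
    (hconst : ∀ v w : placesOver F₀ p, (ofInput I).logQloc p v = (ofInput I).logQloc p w)
    (i : Fin I.X.lstar) (e : Fin ((i : ℕ) + 1 + 1) → placesOver F₀ p) :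
    (ofInput I).M.logμ ((ofInput I).M.hullUTheta (ofInput I).ind3 p ((i : ℕ) + 1) e) =
      (ofInput I).M.logμ ((ofInput I).M.hullUThetaSlot (ofInput I).ind3 p ((i : ℕ) + 1) e) := by
  have hQ : (ofInput I).M.primePart p = realPrimePacketWith p (I.σ.localFieldFamily p hp.out)
      (mScale p (I.σ.localFieldFamily p hp.out)) (mScale_ne_zero p (I.σ.localFieldFamily p hp.out))
      (mScale_perm p (I.σ.localFieldFamily p hp.out)) :=
    primePart_tensorPacketModelM I.σ.localFieldFamily hp.out
  rw [IndPacketModel.hullUTheta_eq_localHull, IndPacketModel.hullUThetaSlot_eq_slotImagesHull,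
    PrimePacket.localHull_eq_possibleImagesHull]
  have hθ : ∀ a, I.X.thetaPilot i (e a).1 * logNorm F₀ (e a).1 / localDegree F₀ (e a).1 =
      I.X.thetaPilot i (e (Fin.last _)).1 * logNorm F₀ (e (Fin.last _)).1 / localDegree F₀ (e (Fin.last _)).1 := by
    intro a
    rw [thetaValue_eq I i (e a), thetaValue_eq I i (e (Fin.last _)), hconst (e a) (e (Fin.last _))]
  have hB : ∀ σ : Equiv.Perm (Fin ((i : ℕ) + 1 + 1)),
      (ofInput I).M.regionAt (ofInput I).ind3.bare3 p _ (e ∘ σ) =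
        ((ofInput I).M.primePart p).pilotRegion (fun i v => (ofInput I).tΘ i p v) ((i : ℕ) + 1) (e ∘ σ) :=
    fun σ => ofInput_sharp I hp.out _ (e ∘ σ)
  rw [PrimePacket.possibleImagesHull_eq_slotImagesHull_of_eq_with (I.σ.localFieldFamily p hp.out) _ _ _ I.X
    ((ofInput I).M.primePart p) hQ (fun i v => (ofInput I).tΘ i p v) i (fun v => (ofInput I).tΘ_ord i p v) e hθ
    ((ofInput I).M.regionAt (ofInput I).ind3.bare3 p) hB]

/-- **`−|log(Θ)|_(U) = −|log(Θ)|_(P)` (nonarchimedean parts) when the canonical `log(q_v)` is slot-constant over EVERY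
support prime** — the two readings are the same number in regime (a) of plan/c312/STEPV-IND1-NOTE.md.
[cite: Mochizuki2012, IUTchIII Cor. 3.12 p. 174] [cite: Mochizuki2012, IUTchIII Cor. 3.12 proof Step (x) p. 181] -/
theorem negLogThetaNonarch_eq_perImage_of_slotConstant
    (hconst : ∀ p ∈ I.supportPrimes, ∀ v w : placesOver F₀ p,
      (ofInput I).logQloc p v = (ofInput I).logQloc p w) :
    I.negLogThetaNonarch = I.negLogThetaPerImageNonarch := by
  rw [← negLogThetaDH_ofInput, ← lnνL_hullUThetaSlot_ofInput, negLogThetaDH]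
  show (ofInput I).M.lnνL I.X.lstar I.supportPrimes ((ofInput I).M.hullUTheta (ofInput I).ind3) =
    (ofInput I).M.lnνL I.X.lstar I.supportPrimes ((ofInput I).M.hullUThetaSlot (ofInput I).ind3)
  unfold PacketModel.lnνL PacketModel.lnνLp PacketModel.lnνTensorPower
  refine Finset.sum_congr rfl fun p hp => ?_
  haveI : Fact p.Prime := ⟨I.prime_of_mem_supportPrimes hp⟩
  congr 1
  refine Finset.sum_congr rfl fun i _ => Finset.sum_congr rfl fun e _ => ?_
  rw [logμ_hullUTheta_eq_hullUThetaSlot_ofInput I (hconst p hp) i e]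

/-- Hence `−|log(Θ)|_(U) = −|log(Θ)|_(P)` with the archimedean summand too. [cite: Mochizuki2012, IUTchIII Cor. 3.12 p. 174] -/
theorem negLogTheta_eq_perImage_of_slotConstant
    (hconst : ∀ p ∈ I.supportPrimes, ∀ v w : placesOver F₀ p,
      (ofInput I).logQloc p v = (ofInput I).logQloc p w) :
    I.negLogTheta = I.negLogThetaPerImage := by
  unfold ThetaVolumeInput.negLogTheta ThetaVolumeInput.negLogThetaPerImage
  rw [negLogThetaNonarch_eq_perImage_of_slotConstant I hconst]

/-- **Cor. 3.12 in reading (U) ↔ Cor. 3.12 in reading (P) on slot-constant data**: the same CLAIM.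
[cite: Mochizuki2012, IUTchIII Cor. 3.12 p. 174] [claim: Mochizuki2012, status: disputed] -/
theorem cor312Of_iff_perImage_of_slotConstant
    (hconst : ∀ p ∈ I.supportPrimes, ∀ v w : placesOver F₀ p,
      (ofInput I).logQloc p v = (ofInput I).logQloc p w) :
    I.Cor312Of ↔ I.Cor312PerImageOf := by
  unfold ThetaVolumeInput.Cor312Of ThetaVolumeInput.Cor312PerImageOf
  rw [negLogTheta_eq_perImage_of_slotConstant I hconst]

/-- The nonarchimedean forms likewise. [cite: Mochizuki2012, IUTchIII Cor. 3.12 p. 174] [claim: Mochizuki2012, status: disputed] -/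
theorem cor312NonarchOf_iff_perImage_of_slotConstant
    (hconst : ∀ p ∈ I.supportPrimes, ∀ v w : placesOver F₀ p,
      (ofInput I).logQloc p v = (ofInput I).logQloc p w) :
    I.Cor312NonarchOf ↔ I.Cor312PerImageNonarchOf := by
  unfold ThetaVolumeInput.Cor312NonarchOf ThetaVolumeInput.Cor312PerImageNonarchOf
  rw [negLogThetaNonarch_eq_perImage_of_slotConstant I hconst]

/-- The computable halves likewise: `HullEstimateOf I δ ↔ HullEstimatePerImageOf I δ` on slot-constant data.
[cite: Mochizuki2012, IUTchIV Thm. 1.10 Steps (v)–(viii) p. 27–31] -/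
theorem hullEstimateOf_iff_perImage_of_slotConstant
    (hconst : ∀ p ∈ I.supportPrimes, ∀ v w : placesOver F₀ p,
      (ofInput I).logQloc p v = (ofInput I).logQloc p w) (δ : ℝ) :
    I.HullEstimateOf δ ↔ I.HullEstimatePerImageOf δ := by
  unfold ThetaVolumeInput.HullEstimateOf ThetaVolumeInput.HullEstimatePerImageOf
  rw [negLogThetaNonarch_eq_perImage_of_slotConstant I hconst]

/-! ## `F_mod` of degree one: the two readings coincide outright -/

/-- **For `F_mod` of degree one (`F_mod = ℚ` up to isomorphism) the two readings of `−|log(Θ)|` are the same number**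
(one place over each prime: every collection is slot-constant). [cite: Mochizuki2012, IUTchIII Cor. 3.12 p. 174] -/
theorem negLogTheta_eq_perImage_of_finrank_eq_one (hF : Module.finrank ℚ F₀ = 1) :
    I.negLogTheta = I.negLogThetaPerImage :=
  negLogTheta_eq_perImage_of_slotConstant I fun p hp v w => by
    haveI : Fact p.Prime := ⟨I.prime_of_mem_supportPrimes hp⟩
    exact slotConstant_of_finrank_eq_one hF (fun v => (ofInput I).logQloc p v) v w

/-- **… so Cor. 3.12 in reading (U) and in reading (P) are the SAME CLAIM for `F_mod` of degree one** (RISK 7 is void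
at `d_mod = 1`). [cite: Mochizuki2012, IUTchIII Cor. 3.12 p. 174] [claim: Mochizuki2012, status: disputed] -/
theorem cor312Of_iff_perImage_of_finrank_eq_one (hF : Module.finrank ℚ F₀ = 1) :
    I.Cor312Of ↔ I.Cor312PerImageOf :=
  cor312Of_iff_perImage_of_slotConstant I fun p hp v w => by
    haveI : Fact p.Prime := ⟨I.prime_of_mem_supportPrimes hp⟩
    exact slotConstant_of_finrank_eq_one hF (fun v => (ofInput I).logQloc p v) v w

/-- … and the computable halves too. [cite: Mochizuki2012, IUTchIV Thm. 1.10 Steps (v)–(viii) p. 27–31] -/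
theorem hullEstimateOf_iff_perImage_of_finrank_eq_one (hF : Module.finrank ℚ F₀ = 1) (δ : ℝ) :
    I.HullEstimateOf δ ↔ I.HullEstimatePerImageOf δ :=
  hullEstimateOf_iff_perImage_of_slotConstant I (fun p hp v w => by
    haveI : Fact p.Prime := ⟨I.prime_of_mem_supportPrimes hp⟩
    exact slotConstant_of_finrank_eq_one hF (fun v => (ofInput I).logQloc p v) v w) δ

end DHData

end Summit.ABC.IUTFork

end
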